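import Summits.CriticalPhenomena.CardyFormulaZ2.Theorems.CardyComplexConeParafermionToSLESixFamiliesDiamondDefs
import HarnessLib

/-!
# Touch mass from per-site touch bounds (summation glue for S3 (c))

Crux `ParafermionToSLESixFamilies` (stmt-CriticalPhenomena-11389), route `CardyComplexCone`, line
`potential-darboux-picard-diamond`, stub S3 `stub_closedPrecompactness : ClosedPrecompactness`
(`…DiamondDefs.lean`), conjunct (c): `c₀ ≤ touchMass (Λ δ) δ p q (‖q-p‖/4) (3‖q-p‖/4)` eventually, where
`touchMass E δ p q s t = δ^{2/3} · ∑ᶠ_{x}` of `touchProb E x` over the touch sites within `3δ` of `[p, q]` whose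
coordinate along the segment lies in `[s, t]` (`…IicDefs.touchSites/touchProb`).

Every route to (c) produces TWO lattice estimates — a COUNT (at least `N ≍ ‖q-p‖/δ` touch sites in the window,
local structure of an admissible discretisation near a straight diagonal side) and a PER-SITE LOWER BOUND
(`touchProb ≥ θ ≍ δ^{1/3}` there: the diagonal half-plane one-arm lower bound `DiagHalfPlaneOneArmLower`,
conditional on `IkhlefPonsaingFirstPassage`, glued to the wired arc by the tree's half-plane U-catch and
Harris–FKG) — and then needs the bookkeeping below to turn them into `touchMass ≥ δ^{2/3}·N·θ ≍ ‖q-p‖^{2/3}`: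

* `touchMass_ge_card_mul` — if `T` is a finite set of touch sites in the window, each with `touchProb ≥ θ`,
  then `δ^{2/3} · (#T · θ) ≤ touchMass E δ p q s t` (the `∑ᶠ` is a genuine finite sum of non-negative terms
  as soon as the touch sites are finitely many, `touchSites_finite`).
-/

noncomputable section

namespace Summit.CriticalPhenomena.CardyFormulaZ2.Cruxes.ParafermionToSLESixFamilies.PotentialDarbouxPicardDiamond

open scoped Topology BigOperators
open Filter Set Metric Complex
open Literature.Probability.LatticeModels Literature.Probability.Percolation
open Summit.CriticalPhenomena.CardyFormulaZ2.Cruxes.ParafermionToSLESixFamilies.IicTraceFluxPairing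

/-- **Touch mass from per-site bounds.** For a datum `E` with finitely many touch sites, a mesh `δ ≥ 0`, and
a finite set `T` of touch sites lying in the window of `touchMass E δ p q s t` (within `3δ` of `[p, q]`,
coordinate along the segment in `[s, t]`), each of touch probability `≥ θ`:
`δ^{2/3} · (#T · θ) ≤ touchMass E δ p q s t`. -/
theorem touchMass_ge_card_mul : ∀ (E : DiscreteDobrushin) (δ : ℝ) (p q : ℂ) (s t θ : ℝ) (T : Finset (Site 2)), 0 ≤ δ → (touchSites E).Finite → (∀ x ∈ T, x ∈ touchSites E ∧ infDist (meshPoint δ x) (segment ℝ p q) ≤ 3 * δ ∧ s ≤ proj p q (meshPoint δ x) ∧ proj p q (meshPoint δ x) ≤ t) → (∀ x ∈ T, θ ≤ touchProb E x) → δ ^ ((2:ℝ) / 3) * (T.card * θ) ≤ touchMass E δ p q s t := by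
  intro E δ p q s t θ T hδ hfin hT hθ
  unfold touchMass
  refine mul_le_mul_of_nonneg_left ?_ (Real.rpow_nonneg hδ _)
  set W : Set (Site 2) := {x ∈ touchSites E | infDist (meshPoint δ x) (segment ℝ p q) ≤ 3 * δ ∧
    s ≤ proj p q (meshPoint δ x) ∧ proj p q (meshPoint δ x) ≤ t} with hW
  have hWfin : W.Finite := hfin.subset (sep_subset _ _)
  have hTW : T ⊆ hWfin.toFinset := fun x hx => hWfin.mem_toFinset.2 (hT x hx)
  rw [finsum_eq_sum_of_support_subset _ (s := hWfin.toFinset)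
    (fun x hx => by exact Finset.mem_coe.2 (hWfin.mem_toFinset.2 (support_indicator_subset hx)))]
  calc (T.card : ℝ) * θ = ∑ _x ∈ T, θ := by rw [Finset.sum_const, nsmul_eq_mul]
    _ ≤ ∑ x ∈ T, touchProb E x := Finset.sum_le_sum hθ
    _ = ∑ x ∈ T, W.indicator (touchProb E) x :=
        Finset.sum_congr rfl fun x hx => (indicator_of_mem (show x ∈ W from hT x hx) _).symm
    _ ≤ ∑ x ∈ hWfin.toFinset, W.indicator (touchProb E) x :=
        Finset.sum_le_sum_of_subset_of_nonneg hTW fun x _ _ =>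
          indicator_nonneg (fun y _ => touchProb_nonneg E y) x

end Summit.CriticalPhenomena.CardyFormulaZ2.Cruxes.ParafermionToSLESixFamilies.PotentialDarbouxPicardDiamond

end
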